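import Mathlib
import Literature.MathematicalPhysics.MHD.BallooningSAlphaSplineWitness
import HarnessLib

/-!
# The `s–α` energy of a FIXED trial function is a quadratic POLYNOMIAL in `(s, α)` —
# `W = F₀ + A s² + B sα + C α² + E α` with five integral coefficients — so one finite-element trial function,
# certified coefficient by coefficient, yields an explicit CONIC REGION of instability, uniform in `(s, α)`

Topic `Literature/MathematicalPhysics/MHD` (namespace = path; sub-namespace `Ballooning.SAlpha.Spline`, that of
`BallooningSAlphaSplineWitness.lean`, whose piecewise polynomials `pw`, programs and route are used BY IMPORT).  Written for
the venture ladder GRIDFUSION, rung F3, by gridfusion-lit-3 (g14), 2026-08-28.  0 named facts, 0 kit.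

## What is typed and PROVED
Freidberg's one-surface functional (12.38) reduced with (12.97), `W[X; a, b] = ∫ [(1 + Λ²)X′² − α(Λ sin θ + cos θ)X²]`,
`Λ = sθ − α sin θ`, is — for FIXED `(X, X′)` and window — the polynomial
`W(s, α) = F₀ + A s² + B sα + C α² + E α`, `F₀ = ∫X′²`, `A = ∫θ²X′²`, `B = −∫θ sin θ (2X′² + X²)`, `C = ∫sin²θ (X′² + X²)`,
`E = −∫cos θ X²` (expand `Λ²` and `αΛ sin θ`; `shiftedDensity_eq_quadratic`).  §2 writes the five coefficient densities of a
polynomial piece as straight-line programs of the tree's Taylor-model lane (`progF0 … progE`, semantics PROVED: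
`toFunP_progF0 … toFunP_progE`); §3 transfers per-panel certified segments of the programs to the spline's coefficient
densities (`fsegOK_coefF0 … fsegOK_coefE`, as `fsegOK_piece`); §4 ★ `unstableWitness_of_spline_conic`: if the five
coefficient integrals of a matched spline vanishing at the ends of its window are enclosed (scale `S`) with upper ends
`h₀, h_A, h_B, h_C, h_E ∈ ℤ`, then for ALL REAL `s, α ≥ 0` with `h₀ + h_A s² + h_B sα + h_C α² + h_E α < 0` the spline is an
`UnstableWitness s α` on its window — an explicit conic region of the `s–α` plane certified unstable by ONE trial function
(the finite-element analogue of Fundamenski's cosine conic (4.158)–(4.159), `BallooningSAlphaCosineTrialFunction.lean`).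
Instances (kernel certificates) live under `Summits/Ventures/FusionMHD/Bench/`.

## THREE COLUMNS
CERTIFIED-capable: conic regions `{q < 0} ∩ {s, α ≥ 0}` of the MODEL's unstable set from five integer enclosures per trial
function.  VALIDATED: Fig. 12.5.  MODELLED: the `s–α` model; «unstable» in the one-surface (Newcomb) sense of
`SAlpha.UnstableWitness`; representation step quoted in `BallooningSAlpha.lean`.

## Sources
* J. P. Freidberg, *Ideal MHD*, CUP 2014 [Freidberg2014] §12.3 (12.38)–(12.40), §12.6.2 (12.97)
  [galaxy:panama:388488381857833 p0474–p0475, p0488–p0490]; §8.7 (finite elements) [p0318].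
* W. Fundamenski, *Power Exhaust in Fusion Plasmas*, CUP 2009 [Fundamenski2009] §4 (4.158)–(4.159): the cosine-trial-function
  conic [corpus: book:fundamenski2009-power-exhaust-fusion-plasmas p0170].
* A. Mahboubi, G. Melquiond, T. Sibut-Pinote 2016 [MahboubiMelquiondSibutpinote2016] §3.2–3.3 (rigorous polynomial
  approximation and panel sums — the certificate format).
-/

noncomputable section

open Real MeasureTheory intervalIntegral Set
open Literature.Analysis.ValidatedNumerics Literature.Analysis.ValidatedNumerics.PolyMP
open Literature.Analysis.ValidatedNumerics.NumericsMP Literature.Analysis.ValidatedNumerics.ExpPoly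

namespace Literature.MathematicalPhysics.MHD

namespace Ballooning

namespace SAlpha

namespace Spline

/-! ## §1 The five coefficient densities and the polynomial identity -/

/-- `X′²` (coefficient of `1`), window coordinates `u = θ − a`. [cite: Freidberg2014, §12.3 eq. (12.38)] -/
def coefF0 (_a : ℝ) (_U U' : ℝ → ℝ) (u : ℝ) : ℝ := U' u ^ 2

/-- `θ²X′²` (coefficient of `s²`). [cite: Freidberg2014, §12.3 eq. (12.38)] -/
def coefA (a : ℝ) (_U U' : ℝ → ℝ) (u : ℝ) : ℝ := (a + u) ^ 2 * U' u ^ 2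

/-- `−θ sin θ (2X′² + X²)` (coefficient of `sα`). [cite: Freidberg2014, §12.3 eq. (12.38)] -/
def coefB (a : ℝ) (U U' : ℝ → ℝ) (u : ℝ) : ℝ := -((a + u) * Real.sin (a + u) * (2 * U' u ^ 2 + U u ^ 2))

/-- `sin²θ (X′² + X²)` (coefficient of `α²`). [cite: Freidberg2014, §12.3 eq. (12.38)] -/
def coefC (a : ℝ) (U U' : ℝ → ℝ) (u : ℝ) : ℝ := Real.sin (a + u) ^ 2 * (U' u ^ 2 + U u ^ 2)

/-- `−cos θ X²` (coefficient of `α`). [cite: Freidberg2014, §12.3 eq. (12.38)] -/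
def coefE (a : ℝ) (U _U' : ℝ → ℝ) (u : ℝ) : ℝ := -(Real.cos (a + u) * U u ^ 2)

/-- THE POLYNOMIAL IDENTITY: the shifted `s–α` density is `F₀ + s²A + sαB + α²C + αE` pointwise.
[cite: Freidberg2014, §12.6.2 eq. (12.97)] (expand `Λ = sθ − α sin θ`) -/
theorem shiftedDensity_eq_quadratic (s α a : ℝ) (U U' : ℝ → ℝ) (u : ℝ) :
    shiftedDensity s α a U U' u
      = coefF0 a U U' u + s ^ 2 * coefA a U U' u + s * α * coefB a U U' u + α ^ 2 * coefC a U U' u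
        + α * coefE a U U' u := by
  unfold shiftedDensity bending drive shearParam coefF0 coefA coefB coefC coefE
  ring

/-! ## §2 The coefficient densities of a polynomial piece as straight-line programs -/

/-- Program for `X′²` of the piece `(p, p′)` (registers `p′(u), p′(u)²`). [cite: MahboubiMelquiondSibutpinote2016, Sect. 3.2] -/
def progF0 (_a : ℚ) (_lx lxd : Poly) : TProg :=
  [ TOp.base (SOp.poly lxd), TOp.base (SOp.mul 0 0) ]

/-- Program for `θ²X′²` (registers `θ = a + u, θ², p′, p′², θ²p′²`). [cite: MahboubiMelquiondSibutpinote2016, Sect. 3.2] -/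
def progA (a : ℚ) (_lx lxd : Poly) : TProg :=
  [ TOp.base (SOp.poly [a, 1]), TOp.base (SOp.mul 0 0), TOp.base (SOp.poly lxd), TOp.base (SOp.mul 0 0),
    TOp.base (SOp.mul 0 2) ]

/-- Program for `−θ sin θ (2X′² + X²)` (registers `θ, sin θ, θ sin θ, p′, p′², 2, 2p′², p, p², p² + 2p′², (…)θ sin θ, −(…)`).
[cite: MahboubiMelquiondSibutpinote2016, Sect. 3.2] -/
def progB (a : ℚ) (lx lxd : Poly) : TProg :=
  [ TOp.base (SOp.poly [a, 1]), TOp.sin 0, TOp.base (SOp.mul 0 1), TOp.base (SOp.poly lxd), TOp.base (SOp.mul 0 0),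
    TOp.base (SOp.poly [2]), TOp.base (SOp.mul 0 1), TOp.base (SOp.poly lx), TOp.base (SOp.mul 0 0),
    TOp.base (SOp.add 0 2), TOp.base (SOp.mul 0 7), TOp.base (SOp.neg 0) ]

/-- Program for `sin²θ (X′² + X²)` (registers `θ, sin θ, sin²θ, p′, p′², p, p², p² + p′², (…)sin²θ`).
[cite: MahboubiMelquiondSibutpinote2016, Sect. 3.2] -/
def progC (a : ℚ) (lx lxd : Poly) : TProg :=
  [ TOp.base (SOp.poly [a, 1]), TOp.sin 0, TOp.base (SOp.mul 0 0), TOp.base (SOp.poly lxd), TOp.base (SOp.mul 0 0),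
    TOp.base (SOp.poly lx), TOp.base (SOp.mul 0 0), TOp.base (SOp.add 0 2), TOp.base (SOp.mul 0 5) ]

/-- Program for `−cos θ X²` (registers `θ, sin θ, cos θ, p, p², p² cos θ, −(…)`). [cite: MahboubiMelquiondSibutpinote2016, Sect. 3.2] -/
def progE (a : ℚ) (lx _lxd : Poly) : TProg :=
  [ TOp.base (SOp.poly [a, 1]), TOp.sin 0, TOp.cos 1, TOp.base (SOp.poly lx), TOp.base (SOp.mul 0 0),
    TOp.base (SOp.mul 0 2), TOp.base (SOp.neg 0) ]

/-- Semantics of `progF0`, PROVED. [cite: MahboubiMelquiondSibutpinote2016, Sect. 3.2] -/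
theorem toFunP_progF0 (a : ℚ) (lx lxd : Poly) (u : ℝ) :
    TProg.toFunP (progF0 a lx lxd) [] u = coefF0 a (Poly.eval lx) (Poly.eval lxd) u := by
  unfold coefF0
  simp [progF0, TProg.toFunP, constStack, TProg.runF, TOp.evalF, SOp.evalF, getReg]
  ring

/-- Semantics of `progA`, PROVED. [cite: MahboubiMelquiondSibutpinote2016, Sect. 3.2] -/
theorem toFunP_progA (a : ℚ) (lx lxd : Poly) (u : ℝ) :
    TProg.toFunP (progA a lx lxd) [] u = coefA a (Poly.eval lx) (Poly.eval lxd) u := by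
  unfold coefA
  simp [progA, TProg.toFunP, constStack, TProg.runF, TOp.evalF, SOp.evalF, getReg]
  ring

/-- Semantics of `progB`, PROVED. [cite: MahboubiMelquiondSibutpinote2016, Sect. 3.2] -/
theorem toFunP_progB (a : ℚ) (lx lxd : Poly) (u : ℝ) :
    TProg.toFunP (progB a lx lxd) [] u = coefB a (Poly.eval lx) (Poly.eval lxd) u := by
  unfold coefB
  simp [progB, TProg.toFunP, constStack, TProg.runF, TOp.evalF, SOp.evalF, getReg]
  ring

/-- Semantics of `progC`, PROVED. [cite: MahboubiMelquiondSibutpinote2016, Sect. 3.2] -/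
theorem toFunP_progC (a : ℚ) (lx lxd : Poly) (u : ℝ) :
    TProg.toFunP (progC a lx lxd) [] u = coefC a (Poly.eval lx) (Poly.eval lxd) u := by
  unfold coefC
  simp [progC, TProg.toFunP, constStack, TProg.runF, TOp.evalF, SOp.evalF, getReg]
  ring

/-- Semantics of `progE`, PROVED. [cite: MahboubiMelquiondSibutpinote2016, Sect. 3.2] -/
theorem toFunP_progE (a : ℚ) (lx lxd : Poly) (u : ℝ) :
    TProg.toFunP (progE a lx lxd) [] u = coefE a (Poly.eval lx) (Poly.eval lxd) u := by
  unfold coefE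
  simp [progE, TProg.toFunP, constStack, TProg.runF, TOp.evalF, SOp.evalF, getReg]
  ring

/-! ## §3 The spline's coefficient densities; transfer of per-panel certificates -/

/-- `X′²` of the spline with pieces `ps` (cells of width `2mh` from `u = 0`). [cite: Freidberg2014, §8.7 (p0318)] -/
def splineCoefF0 (a h : ℚ) (m : ℕ) (ps : List Poly) : ℝ → ℝ :=
  coefF0 a (pw (2 * m * h) 0 ps) (pw (2 * m * h) 0 (ps.map Poly.deriv))

/-- `θ²X′²` of the spline. [cite: Freidberg2014, §8.7 (p0318)] -/
def splineCoefA (a h : ℚ) (m : ℕ) (ps : List Poly) : ℝ → ℝ :=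
  coefA a (pw (2 * m * h) 0 ps) (pw (2 * m * h) 0 (ps.map Poly.deriv))

/-- `−θ sin θ(2X′² + X²)` of the spline. [cite: Freidberg2014, §8.7 (p0318)] -/
def splineCoefB (a h : ℚ) (m : ℕ) (ps : List Poly) : ℝ → ℝ :=
  coefB a (pw (2 * m * h) 0 ps) (pw (2 * m * h) 0 (ps.map Poly.deriv))

/-- `sin²θ(X′² + X²)` of the spline. [cite: Freidberg2014, §8.7 (p0318)] -/
def splineCoefC (a h : ℚ) (m : ℕ) (ps : List Poly) : ℝ → ℝ :=
  coefC a (pw (2 * m * h) 0 ps) (pw (2 * m * h) 0 (ps.map Poly.deriv))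

/-- `−cos θ X²` of the spline. [cite: Freidberg2014, §8.7 (p0318)] -/
def splineCoefE (a h : ℚ) (m : ℕ) (ps : List Poly) : ℝ → ℝ :=
  coefE a (pw (2 * m * h) 0 ps) (pw (2 * m * h) 0 (ps.map Poly.deriv))

/-- [folklore] Congruence of certified segments under equality of the integrands on the closed interval. -/
private theorem fsegOK_congr' {f g : ℝ → ℝ} {q : Poly} {S : ℕ} {a b : ℚ} {lo hi : ℤ}
    (hfg : EqOn f g (uIcc (a : ℝ) (b : ℝ))) (hs : FSegOK f q S a b lo hi) : FSegOK g q S a b lo hi := by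
  obtain ⟨h1, h2, h3⟩ := hs
  have hmul : EqOn (fun t => f t * Poly.eval q t) (fun t => g t * Poly.eval q t) (uIcc (a : ℝ) (b : ℝ)) :=
    fun t ht => by simp only [hfg ht]
  have hint : ∫ t in (a : ℝ)..(b : ℝ), f t * Poly.eval q t = ∫ t in (a : ℝ)..(b : ℝ), g t * Poly.eval q t :=
    intervalIntegral.integral_congr hmul
  refine ⟨by simpa [hint] using h1, by simpa [hint] using h2, ?_⟩
  exact h3.congr (fun t ht => hmul (uIoc_subset_uIcc ht))

/-- [folklore] On the `j`-th Taylor-model panel (inside cell `j / m`) the matched spline and its piecewise formal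
derivative ARE the piece `j / m` and its derivative (finite-element bookkeeping). [cite: Freidberg2014, §8.7 (p0318)] -/
theorem pw_eq_on_panel {h : ℚ} {m : ℕ} {ps : List Poly} (hh : 0 < h) (hm0 : 0 < m)
    (hm : matchesB (2 * m * h) 0 ps = true) (hm' : matchesB (2 * m * h) 0 (ps.map Poly.deriv) = true)
    {j : ℕ} {p : Poly} (hk : ps[j / m]? = some p) {u : ℝ}
    (hu : u ∈ uIcc ((panelLeft h j : ℚ) : ℝ) ((panelLeft h (j + 1) : ℚ) : ℝ)) :
    pw (2 * m * h) 0 ps u = Poly.eval p u ∧ pw (2 * m * h) 0 (ps.map Poly.deriv) u = Poly.eval (Poly.deriv p) u := by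
  have hhR : (0 : ℝ) < h := by exact_mod_cast hh
  have hw : (0 : ℚ) < 2 * m * h := by
    have : (0 : ℚ) < m := by exact_mod_cast hm0
    positivity
  have hk' : (ps.map Poly.deriv)[j / m]? = some (Poly.deriv p) := by simp [hk]
  have hdiv1 : ((m * (j / m) : ℕ) : ℝ) ≤ (j : ℝ) := by exact_mod_cast Nat.mul_div_le j m
  have hdiv2 : ((j + 1 : ℕ) : ℝ) ≤ ((m * (j / m) + m : ℕ) : ℝ) := by
    have h1 : j % m < m := Nat.mod_lt j hm0
    have h2 : m * (j / m) + j % m = j := Nat.div_add_mod j m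
    exact_mod_cast (by omega : j + 1 ≤ m * (j / m) + m)
  push_cast at hdiv1 hdiv2
  have hmR : (0 : ℝ) < m := by exact_mod_cast hm0
  have hcell : u ∈ Icc (((0 : ℚ) : ℝ) + (j / m : ℕ) * ((2 * m * h : ℚ) : ℝ))
      (((0 : ℚ) : ℝ) + ((j / m : ℕ) + 1) * ((2 * m * h : ℚ) : ℝ)) := by
    have hle : ((panelLeft h j : ℚ) : ℝ) ≤ ((panelLeft h (j + 1) : ℚ) : ℝ) := by
      simp only [panelLeft]; push_cast; nlinarith
    rw [uIcc_of_le hle] at hu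
    obtain ⟨h1, h2⟩ := hu
    simp only [panelLeft] at h1 h2
    push_cast at h1 h2 ⊢
    constructor <;> nlinarith
  exact ⟨pw_eqOn hw ps 0 hm (j / m) p hk hcell, pw_eqOn hw (ps.map Poly.deriv) 0 hm' (j / m) (Poly.deriv p) hk' hcell⟩

/-- TRANSFER for `F₀`. [cite: MahboubiMelquiondSibutpinote2016, Sect. 3.3] -/
theorem fsegOK_coefF0 {a h : ℚ} {m : ℕ} {ps : List Poly} (hh : 0 < h) (hm0 : 0 < m)
    (hm : matchesB (2 * m * h) 0 ps = true) (hm' : matchesB (2 * m * h) 0 (ps.map Poly.deriv) = true)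
    {j : ℕ} {p : Poly} (hk : ps[j / m]? = some p) {S : ℕ} {lo hi : ℤ}
    (hc : FSegOK (TProg.toFunP (progF0 a p (Poly.deriv p)) []) [1] S (panelLeft h j) (panelLeft h (j + 1)) lo hi) :
    FSegOK (splineCoefF0 a h m ps) [1] S (panelLeft h j) (panelLeft h (j + 1)) lo hi := by
  refine fsegOK_congr' (fun u hu => ?_) hc
  obtain ⟨-, e2⟩ := pw_eq_on_panel hh hm0 hm hm' hk hu
  rw [toFunP_progF0]
  simp only [splineCoefF0, coefF0, e2]

/-- TRANSFER for `A`. [cite: MahboubiMelquiondSibutpinote2016, Sect. 3.3] -/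
theorem fsegOK_coefA {a h : ℚ} {m : ℕ} {ps : List Poly} (hh : 0 < h) (hm0 : 0 < m)
    (hm : matchesB (2 * m * h) 0 ps = true) (hm' : matchesB (2 * m * h) 0 (ps.map Poly.deriv) = true)
    {j : ℕ} {p : Poly} (hk : ps[j / m]? = some p) {S : ℕ} {lo hi : ℤ}
    (hc : FSegOK (TProg.toFunP (progA a p (Poly.deriv p)) []) [1] S (panelLeft h j) (panelLeft h (j + 1)) lo hi) :
    FSegOK (splineCoefA a h m ps) [1] S (panelLeft h j) (panelLeft h (j + 1)) lo hi := by
  refine fsegOK_congr' (fun u hu => ?_) hc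
  obtain ⟨-, e2⟩ := pw_eq_on_panel hh hm0 hm hm' hk hu
  rw [toFunP_progA]
  simp only [splineCoefA, coefA, e2]

/-- TRANSFER for `B`. [cite: MahboubiMelquiondSibutpinote2016, Sect. 3.3] -/
theorem fsegOK_coefB {a h : ℚ} {m : ℕ} {ps : List Poly} (hh : 0 < h) (hm0 : 0 < m)
    (hm : matchesB (2 * m * h) 0 ps = true) (hm' : matchesB (2 * m * h) 0 (ps.map Poly.deriv) = true)
    {j : ℕ} {p : Poly} (hk : ps[j / m]? = some p) {S : ℕ} {lo hi : ℤ}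
    (hc : FSegOK (TProg.toFunP (progB a p (Poly.deriv p)) []) [1] S (panelLeft h j) (panelLeft h (j + 1)) lo hi) :
    FSegOK (splineCoefB a h m ps) [1] S (panelLeft h j) (panelLeft h (j + 1)) lo hi := by
  refine fsegOK_congr' (fun u hu => ?_) hc
  obtain ⟨e1, e2⟩ := pw_eq_on_panel hh hm0 hm hm' hk hu
  rw [toFunP_progB]
  simp only [splineCoefB, coefB, e1, e2]

/-- TRANSFER for `C`. [cite: MahboubiMelquiondSibutpinote2016, Sect. 3.3] -/
theorem fsegOK_coefC {a h : ℚ} {m : ℕ} {ps : List Poly} (hh : 0 < h) (hm0 : 0 < m)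
    (hm : matchesB (2 * m * h) 0 ps = true) (hm' : matchesB (2 * m * h) 0 (ps.map Poly.deriv) = true)
    {j : ℕ} {p : Poly} (hk : ps[j / m]? = some p) {S : ℕ} {lo hi : ℤ}
    (hc : FSegOK (TProg.toFunP (progC a p (Poly.deriv p)) []) [1] S (panelLeft h j) (panelLeft h (j + 1)) lo hi) :
    FSegOK (splineCoefC a h m ps) [1] S (panelLeft h j) (panelLeft h (j + 1)) lo hi := by
  refine fsegOK_congr' (fun u hu => ?_) hc
  obtain ⟨e1, e2⟩ := pw_eq_on_panel hh hm0 hm hm' hk hu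
  rw [toFunP_progC]
  simp only [splineCoefC, coefC, e1, e2]

/-- TRANSFER for `E`. [cite: MahboubiMelquiondSibutpinote2016, Sect. 3.3] -/
theorem fsegOK_coefE {a h : ℚ} {m : ℕ} {ps : List Poly} (hh : 0 < h) (hm0 : 0 < m)
    (hm : matchesB (2 * m * h) 0 ps = true) (hm' : matchesB (2 * m * h) 0 (ps.map Poly.deriv) = true)
    {j : ℕ} {p : Poly} (hk : ps[j / m]? = some p) {S : ℕ} {lo hi : ℤ}
    (hc : FSegOK (TProg.toFunP (progE a p (Poly.deriv p)) []) [1] S (panelLeft h j) (panelLeft h (j + 1)) lo hi) :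
    FSegOK (splineCoefE a h m ps) [1] S (panelLeft h j) (panelLeft h (j + 1)) lo hi := by
  refine fsegOK_congr' (fun u hu => ?_) hc
  obtain ⟨e1, -⟩ := pw_eq_on_panel hh hm0 hm hm' hk hu
  rw [toFunP_progE]
  simp only [splineCoefE, coefE, e1]

/-! ## §4 The conic region of instability of one spline trial function -/

/-- [folklore] A certified segment with weight `[1]` bounds the plain integral from above by `hi / S` and makes the
integrand interval integrable. -/
private theorem seg_le {f : ℝ → ℝ} {S : ℕ} {a b : ℚ} {lo hi : ℤ} (hs : FSegOK f [1] S a b lo hi) (hS : 0 < S) :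
    (∫ t in (a : ℝ)..(b : ℝ), f t) ≤ (hi : ℝ) / S ∧ IntervalIntegrable f volume (a : ℝ) (b : ℝ) := by
  obtain ⟨-, h2, h3⟩ := hs
  have e : (fun t => f t * Poly.eval [1] t) = f := by
    funext t; simp [Poly.eval]
  rw [e] at h2 h3
  have hSR : (0 : ℝ) < S := by exact_mod_cast hS
  refine ⟨?_, h3⟩
  rw [le_div_iff₀ hSR]
  linarith

/-- ★ THE CONIC REGION OF ONE TRIAL FUNCTION, PROVED: a matched `C¹` spline (pieces `ps` on cells of width `2mh`, `m`
Taylor-model panels of half-width `h` per cell) vanishing at both ends of its window `[a, a + 2m·|ps|·h]`, whose five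
coefficient integrals `F₀, A, B, C, E` are enclosed at scale `S` with integer upper ends `h₀, h_A, h_B, h_C, h_E`, is an
`s–α` INSTABILITY WITNESS at EVERY real `(s, α)` with `s ≥ 0`, `α ≥ 0` and `h₀ + h_A s² + h_B sα + h_C α² + h_E α < 0`
(`S·W(s, α) ≤` that polynomial, the monomials being non-negative).  One certificate, a whole conic region.
[cite: Freidberg2014, §12.3 eqs. (12.38)–(12.40)] («if W < 0 the plasma is unstable», uniformly in `(s, α)`) -/
theorem unstableWitness_of_spline_conic {a h : ℚ} {m : ℕ} {ps : List Poly} {S : ℕ}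
    {l₀ h₀ lA hA lB hB lC hC lE hE : ℤ}
    (hh : 0 < h) (hm0 : 0 < m) (hne : ps ≠ [])
    (hm : matchesB (2 * m * h) 0 ps = true) (hm' : matchesB (2 * m * h) 0 (ps.map Poly.deriv) = true)
    (hA0 : Poly.evalQ (ps.head hne) 0 = 0)
    (hB0 : Poly.evalQ (ps.getLast hne) (2 * m * ps.length * h) = 0) (hS : 0 < S)
    (s₀ : FSegOK (splineCoefF0 a h m ps) [1] S (panelLeft h 0) (panelLeft h (m * ps.length)) l₀ h₀)
    (sA : FSegOK (splineCoefA a h m ps) [1] S (panelLeft h 0) (panelLeft h (m * ps.length)) lA hA)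
    (sB : FSegOK (splineCoefB a h m ps) [1] S (panelLeft h 0) (panelLeft h (m * ps.length)) lB hB)
    (sC : FSegOK (splineCoefC a h m ps) [1] S (panelLeft h 0) (panelLeft h (m * ps.length)) lC hC)
    (sE : FSegOK (splineCoefE a h m ps) [1] S (panelLeft h 0) (panelLeft h (m * ps.length)) lE hE)
    {s α : ℝ} (hs : 0 ≤ s) (hα : 0 ≤ α)
    (hq : (h₀ : ℝ) + hA * s ^ 2 + hB * (s * α) + hC * α ^ 2 + hE * α < 0) :
    UnstableWitness s α (a : ℝ) ((a : ℝ) + 2 * (m : ℝ) * (ps.length : ℝ) * (h : ℝ))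
      (trialX h m ps a) (trialX' h m ps a) := by
  have hmQ : (0 : ℚ) < m := by exact_mod_cast hm0
  have hw : (0 : ℚ) < 2 * m * h := by positivity
  have hhR : (0 : ℝ) < h := by exact_mod_cast hh
  have hmR : (1 : ℝ) ≤ (m : ℝ) := by exact_mod_cast hm0
  have hn : 0 < ps.length := List.length_pos_of_ne_nil hne
  have hnR : (1 : ℝ) ≤ (ps.length : ℝ) := by exact_mod_cast hn
  refine ⟨by nlinarith [mul_pos (mul_pos (by linarith : (0:ℝ) < m) (by linarith : (0:ℝ) < ps.length)) hhR],
    ?_, ?_, ?_, ?_⟩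
  · intro θ _
    have hd := hasDerivAt_pw hw ps 0 hm hm' (θ - a)
    exact hd.comp_sub_const θ (a : ℝ)
  · have e := pw_eqOn hw ps 0 hm 0 (ps.head hne) (by
        cases ps with
        | nil => exact absurd rfl hne
        | cons p ps => rfl)
      (x := ((0 : ℚ) : ℝ)) (by
        constructor <;> push_cast <;> nlinarith [mul_pos (by linarith : (0:ℝ) < m) hhR])
    show pw (2 * m * h) 0 ps ((a : ℝ) - a) = 0
    rw [sub_self]
    have e' : pw (2 * m * h) 0 ps (((0 : ℚ) : ℝ)) = Poly.eval (ps.head hne) (((0 : ℚ) : ℝ)) := e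
    push_cast at e'
    rw [e', ← Rat.cast_zero, ← Poly.eval_evalQ, hA0, Rat.cast_zero]
  · have hcast : ((ps.length - 1 : ℕ) : ℝ) = (ps.length : ℝ) - 1 := by
      rw [Nat.cast_sub hn]; simp
    have hcell : (((2 * m * ps.length * h : ℚ)) : ℝ) ∈
        Icc (((0 : ℚ) : ℝ) + (ps.length - 1 : ℕ) * ((2 * m * h : ℚ) : ℝ))
          (((0 : ℚ) : ℝ) + ((ps.length - 1 : ℕ) + 1) * ((2 * m * h : ℚ) : ℝ)) := by
      constructor <;> push_cast <;> rw [hcast] <;> nlinarith [mul_pos (by linarith : (0:ℝ) < m) hhR]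
    have hlast : ps[ps.length - 1]? = some (ps.getLast hne) := by
      rw [List.getLast_eq_getElem]; simp [Nat.sub_lt hn Nat.one_pos]
    have e := pw_eqOn hw ps 0 hm (ps.length - 1) (ps.getLast hne) hlast hcell
    show pw (2 * m * h) 0 ps ((a : ℝ) + 2 * (m : ℝ) * (ps.length : ℝ) * (h : ℝ) - a) = 0
    have e2 : (a : ℝ) + 2 * (m : ℝ) * (ps.length : ℝ) * (h : ℝ) - a = (((2 * m * ps.length * h : ℚ)) : ℝ) := by
      push_cast; ring
    rw [e2, e, ← Poly.eval_evalQ, hB0, Rat.cast_zero]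
  · -- `W(s, α) = ∫F₀ + s²∫A + sα∫B + α²∫C + α∫E < 0`
    have hSR : (0 : ℝ) < S := by exact_mod_cast hS
    obtain ⟨b0, i0⟩ := seg_le s₀ hS
    obtain ⟨bA, iA⟩ := seg_le sA hS
    obtain ⟨bB, iB⟩ := seg_le sB hS
    obtain ⟨bC, iC⟩ := seg_le sC hS
    obtain ⟨bE, iE⟩ := seg_le sE hS
    have e0 : ((panelLeft h 0 : ℚ) : ℝ) = 0 := by simp [panelLeft]
    have e1 : ((panelLeft h (m * ps.length) : ℚ) : ℝ)
        = ((a : ℝ) + 2 * (m : ℝ) * (ps.length : ℝ) * (h : ℝ)) - a := by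
      simp only [panelLeft]; push_cast; ring
    rw [e0, e1] at b0 bA bB bC bE i0 iA iB iC iE
    show energy s α (fun θ => pw (2 * m * h) 0 ps (θ - a))
      (fun θ => pw (2 * m * h) 0 (ps.map Poly.deriv) (θ - a)) a
        ((a : ℝ) + 2 * (m : ℝ) * (ps.length : ℝ) * (h : ℝ)) < 0
    rw [energy_translate]
    set L : ℝ := ((a : ℝ) + 2 * (m : ℝ) * (ps.length : ℝ) * (h : ℝ)) - a with hL
    have eq : ∫ u in (0 : ℝ)..L, shiftedDensity s α a (pw (2 * m * h) 0 ps) (pw (2 * m * h) 0 (ps.map Poly.deriv)) u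
        = (∫ u in (0 : ℝ)..L, splineCoefF0 a h m ps u) + s ^ 2 * (∫ u in (0 : ℝ)..L, splineCoefA a h m ps u)
          + s * α * (∫ u in (0 : ℝ)..L, splineCoefB a h m ps u) + α ^ 2 * (∫ u in (0 : ℝ)..L, splineCoefC a h m ps u)
          + α * (∫ u in (0 : ℝ)..L, splineCoefE a h m ps u) := by
      have hcongr : ∫ u in (0 : ℝ)..L, shiftedDensity s α a (pw (2 * m * h) 0 ps) (pw (2 * m * h) 0 (ps.map Poly.deriv)) u
          = ∫ u in (0 : ℝ)..L, (splineCoefF0 a h m ps u + s ^ 2 * splineCoefA a h m ps u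
              + s * α * splineCoefB a h m ps u + α ^ 2 * splineCoefC a h m ps u + α * splineCoefE a h m ps u) := by
        apply intervalIntegral.integral_congr
        intro u _
        simp only [splineCoefF0, splineCoefA, splineCoefB, splineCoefC, splineCoefE]
        exact shiftedDensity_eq_quadratic s α a _ _ u
      rw [hcongr]
      have iA' := iA.const_mul (s ^ 2)
      have iB' := iB.const_mul (s * α)
      have iC' := iC.const_mul (α ^ 2)
      have iE' := iE.const_mul α
      rw [intervalIntegral.integral_add (((i0.add iA').add iB').add iC') iE',
        intervalIntegral.integral_add ((i0.add iA').add iB') iC',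
        intervalIntegral.integral_add (i0.add iA') iB', intervalIntegral.integral_add i0 iA']
      simp only [intervalIntegral.integral_const_mul]
    rw [eq]
    have t0 : (∫ u in (0 : ℝ)..L, splineCoefF0 a h m ps u) ≤ (h₀ : ℝ) / S := b0
    have tA : s ^ 2 * (∫ u in (0 : ℝ)..L, splineCoefA a h m ps u) ≤ s ^ 2 * ((hA : ℝ) / S) :=
      mul_le_mul_of_nonneg_left bA (by positivity)
    have tB : s * α * (∫ u in (0 : ℝ)..L, splineCoefB a h m ps u) ≤ s * α * ((hB : ℝ) / S) :=
      mul_le_mul_of_nonneg_left bB (by positivity)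
    have tC : α ^ 2 * (∫ u in (0 : ℝ)..L, splineCoefC a h m ps u) ≤ α ^ 2 * ((hC : ℝ) / S) :=
      mul_le_mul_of_nonneg_left bC (by positivity)
    have tE : α * (∫ u in (0 : ℝ)..L, splineCoefE a h m ps u) ≤ α * ((hE : ℝ) / S) :=
      mul_le_mul_of_nonneg_left bE hα
    have hsum : (h₀ : ℝ) / S + s ^ 2 * ((hA : ℝ) / S) + s * α * ((hB : ℝ) / S) + α ^ 2 * ((hC : ℝ) / S)
        + α * ((hE : ℝ) / S) = ((h₀ : ℝ) + hA * s ^ 2 + hB * (s * α) + hC * α ^ 2 + hE * α) / S := by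
      field_simp
    have hneg : ((h₀ : ℝ) + hA * s ^ 2 + hB * (s * α) + hC * α ^ 2 + hE * α) / S < 0 :=
      div_neg_of_neg_of_pos hq hSR
    linarith

end Spline

end SAlpha

end Ballooning

end Literature.MathematicalPhysics.MHD

end
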